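import Summits.BirchSwinnertonDyer.BirchSwinnertonDyer.Theorems.ErratumRoadFiveNonSurjCornerTwinMuAnDeepOneTwinDefs
import Summits.BirchSwinnertonDyer.Rank1Residual.X11a.PrintDischargeMuTableRecords
import HarnessLib

/-!
# Route `ErratumRoadFive` (K2), crux `NonSurjCorner` (19065), gen-3 child 23047 `NonSurjCornerTwinMuAnDeep`:
# THE TABLE DOOR FOR THE PER-PAIR UNIT — `Theorems.NonSurjCornerTwinMuAnDeepOneTwin` (p766487) from ONE kernel-checkable μ symbol table per DEEP corner
# pair (cell `bsd-stepL`, WIDTH-LEVER lane B `bsd-stepL-corner5-p2` g18; `--supports stmt-BirchSwinnertonDyer-23047 --as helper`)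

WHY. Lane B's deep table door of record (`NonSurjCornerDeep.twinMuAnDeep_of_forall_muTableDeep`, g12 p683350) concludes item 23047 from a table at EVERY
Friedberg–Hoffstein twist of every deep pair (`∀ K`). The per-pair unit `NonSurjCornerTwinMuAnDeepOneTwin` (this seat g18, p766487: SOME Heegner field per deep pair;
23047 implies it, and with 23046 and the route items it still gives the crux — `nonSurjCorner_of_kolyZDeep_of_twinMuAnDeepOneTwin_of_items`) needs ONE table per
pair: this file is its door, the same x11a per-pair door `ClassX11a.muAnZeroAt_of_muTable_of_lRatio` at the one displayed twin followed by the split ∕ non-split case split.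
Every one of the 24 known deep corner pairs (22 at `p = 5`, 2 at `p = 7`) has at least one landed `MuTable` record at a Friedberg–Hoffstein twin (lane B Parts
`…TwinMuAnTablesDeepPart1–10`, `…DeepBeyondPart1–10`, `…SevenDeepPart1`); each such record enters this door at its pair — modulo the record's claim
`MuTable.ClaimFor` (D-0014 claim level), the displayed central value, and Mazur's fact by name.

HONEST FRAMING: ONE bookkeeping theorem (no definition, no new named fact, no `sorry`); CONDITIONAL on Mazur's fact by name and on the per-pair displays; the
`∀` over the deep pairs is exactly what is open (an infinite class; no finite instance list); items 19065 ∕ 23047 stay OPEN; closes: none (T7); BSD is proved for no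
curve or class.
References: [MazurTateTeitelbaum1986Invent] §I.10 Prop., §I.12–I.14; [Mazur1978] Cor. 4.1; [SteinWuthrich2013] §3, §4.2; [GreenbergLNM1716] §1 Conj. 1.11 (p. 61);
tree: x11a `X11a/PrintDischargeMuTableRecords.lean`, g12 `…TwinMuAnDeepOfTables.lean`, g18 `…TwinMuAnDeepOneTwinDefs.lean`.
-/

set_option autoImplicit false
set_option linter.dupNamespace false -- `Summit.BirchSwinnertonDyer.BirchSwinnertonDyer` (summit = problem), tree-wide

noncomputable section

open scoped Classical NumberField MatrixGroups ModularForm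

namespace Summit.BirchSwinnertonDyer.BirchSwinnertonDyer.Theorems

open CongruenceSubgroup WeierstrassCurve Literature.NumberTheory.EllipticCurves
  Literature.NumberTheory.EllipticCurves.ModularForms
  Literature.NumberTheory.EllipticCurves.Rank1Residual
  Literature.NumberTheory.EllipticCurves.Rank1Residual.X11aPrintCertificates
  Summit.BirchSwinnertonDyer.Rank1Residual

/-- **`NonSurjCornerTwinMuAnDeepOneTwin` from ONE μ symbol table per DEEP corner pair.** Granted Mazur's fact
`mazur_not_dvd_maninConstant_of_odd`: if at every deep corner pair `(E,p)` SOME imaginary quadratic `K` (`|d_K| > 4`, Heegner for `N_E`,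
`L(E^{(d_K)},1) ≠ 0`) is displayed such that every globally minimal model `Wd = Cd • E^{(d_K)}` that is a non-surjective X11a leaf with
`p ∣ ord_p Δ_min` carries a central value `L(Wd,1) = ℓ·Ω_{Wd}` with `‖ℓ‖_p ≤ 1` and a μ symbol table `t` at `p` with `t.checkRiemannSum = true`,
the split-bit consistency and the claim `t.ClaimFor Wd` (D-0014 claim level), then `NonSurjCornerTwinMuAnDeepOneTwin` — x11a's per-pair door
`ClassX11a.muAnZeroAt_of_muTable_of_lRatio` at that one twin, then the split ∕ non-split case split (as in g12's
`NonSurjCornerDeep.twinMuAnDeep_of_forall_muTableDeep`, whose `∀ K` is replaced by the displayed `∃ K`). This is the door by which ONE landed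
`MuTable` record per deep pair (lane B Parts `…TwinMuAnTables*`; 24 ∕ 24 known deep pairs have one) discharges that pair's instance.
CONDITIONAL; nothing booked; T7. [cite: MazurTateTeitelbaum1986Invent, §I.10 Prop., §I.12–I.14] [cite: Mazur1978, Cor. 4.1]
[cite: SteinWuthrich2013, §3 and §4.2] -/
theorem NonSurjCornerDeep.twinMuAnDeepOneTwin_of_exists_muTableDeep (hM : mazur_not_dvd_maninConstant_of_odd)
    (h : ∀ (W : WeierstrassCurve ℚ) [W.IsElliptic] [W.IsGloballyMinimal] (p : ℕ) [Fact p.Prime],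
      ClassX11b W p → ¬ Surj W p → (p = 5 ∨ p = 7) → p ∣ padicValInt p W.minimalDiscriminantInt →
      ¬ Ram W p → (∃ s : ℚ, shaAn W = (s : ℂ) ∧ 0 < padicValRat p s) →
      ∃ (K : Type) (_ : Field K) (_ : NumberField K),
        IsImaginaryQuadratic K ∧ 4 < (NumberField.discr K).natAbs ∧
        SatisfiesHeegnerHypothesis (W.conductorNorm ℤ) K ∧
        (W.quadraticTwist (NumberField.discr K : ℚ)).entireLFunction 1 ≠ 0 ∧
        ∀ (Wd : WeierstrassCurve ℚ) [Wd.IsElliptic] [Wd.IsGloballyMinimal] (Cd : VariableChange ℚ),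
          Cd • W.quadraticTwist (NumberField.discr K : ℚ) = Wd →
          ClassX11a Wd p → ¬ Surj Wd p → p ∣ padicValInt p Wd.minimalDiscriminantInt →
          ∃ (ℓ : ℚ) (t : MuTable), Wd.entireLFunction 1 = (ℓ : ℂ) * (Wd.realPeriodRat : ℂ) ∧
            ‖((ℓ : ℚ) : ℚ_[p])‖ ≤ 1 ∧ t.p = p ∧ t.checkRiemannSum = true ∧
            (Wd.HasSplitMultiplicativeReductionAtPrime p → t.split = true) ∧ t.ClaimFor Wd) :
    NonSurjCornerTwinMuAnDeepOneTwin := by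
  intro W _ _ p _ hX hns h57 hv hnram hsha
  obtain ⟨K, _, _, hK, hdisc, hHN, hL1, hdata⟩ := h W p hX hns h57 hv hnram hsha
  refine ⟨K, inferInstance, inferInstance, hK, hdisc, hHN, hL1,
    fun Wd _ _ Cd hWd hXa hnsd hvd N _ f hf ϖ hϖ a L hsa hna hL ↦ ?_⟩
  obtain ⟨ℓ, t, hℓ, hℓ1, hp, ht, hts, hT⟩ := hdata Wd Cd hWd hXa hnsd hvd
  -- the X11a lane certificate at the one twin, from the table (x11a's per-pair door)
  obtain ⟨hnsp, hsp⟩ := hXa.muAnZeroAt_of_muTable_of_lRatio hM ℓ hℓ hℓ1 t hp ht hts hT f hf ϖ hϖ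
  by_cases hsplit : Wd.HasSplitMultiplicativeReductionAtPrime p
  · have ha : a = 1 := hsa hsplit
    subst ha
    exact hsp hsplit L ((isMultPAdicLFunctionOf_one_iff L).mp hL)
  · have ha : a = -1 := hna hsplit
    subst ha
    exact hnsp hsplit L hL

end Summit.BirchSwinnertonDyer.BirchSwinnertonDyer.Theorems

end
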